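import Summits.BirchSwinnertonDyer.BirchSwinnertonDyer.Theorems.AlignedTransportAtTwoMainConjectureOfRankZeroBSDAtTwoHalfDescentLayerIndexGrowthFiniteCell
import Summits.BirchSwinnertonDyer.BirchSwinnertonDyer.Theorems.AlignedTransportAtTwoMainConjectureOfRankZeroBSDAtTwoHalfDescentLayerIndexGrowthFiniteCompleteTwo
import Summits.BirchSwinnertonDyer.BirchSwinnertonDyer.Theorems.AlignedTransportAtTwoMainConjectureOfRankZeroBSDAtTwoSelmerLayerMuDoor
import HarnessLib

/-!
# Route `AlignedTransportAtTwo`, crux C2 `MainConjectureOfRankZeroBSDAtTwo` (stmt-BirchSwinnertonDyer-22298):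
# THE GROWTH NUMBER AT FINITE LEVEL, VII — THE NORM-KERNEL DOOR IS COMPLETE ON THE SEED CELL: for `W/ℚ` good ordinary at `2` without rational `2`-torsion abscissa,
# the cyclotomic `ℤ₂`-tower and `X` torsion, `μ(X(W/ℚ_∞)) = 0 ⟺ ∃ n, 0 < #ker(N_{ℚ_{n+1}/ℚ_n} | Sel_{2^∞}(W/ℚ_{n+1})) · #ker g_{n+1} < 2^{2ⁿ}`

HONEST FRAMING (cell `bsd-f1-sign2`, WIDTH-5 attached prover seat `bsd-line-att-p5` gen 57 on line `birth` of the lead `bsd-line-att-p2`;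
`--supports` stmt-BirchSwinnertonDyer-22298, closes nothing; BSD is NOT proved by any of this; the crux C2, its verdict «blocked-on
`Rank1Residual.GreenbergMuConjectureIrreducible`» and every registered stub (P / T / Kμ / LimDoor / MuIneqʳ / PFμ⁺) are untouched). THEOREMS ONLY — no `def`,
no instance, no named fact, no `sorry`. Route-independent. Sequel of `…GrowthFiniteTwo` (`0 < #M_{n+1}·#ker g_{n+1} < 2^{2ⁿ}` ⟹ `μ = 0`), `…GrowthFiniteComplete` (`μ = 0` ⟹
`0 < g_n ≤ B` eventually), `…GrowthFiniteCompleteTwo` (`#ker g_n ≤ C` on the cell) and `…GrowthFiniteCell` (`#M_{n+1} ∣ g_n·#M_{n+1}[2]` without rational `2`-torsion); the one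
missing bound — the `2`-torsion of the norm kernel — comes from gen 43's rank-jump currency: `#M_{n+1}[2] ≤ #Sel_{n+1}[2] ≤ #Sel_∞^{Γ_{n+1}}[2] = #(X/(ω_{n+1},2)X) ≤ #(X/2X)`,
finite when `μ = 0`.

* §1 (any number field, any `p`, `E(K)[p] = 0`, `X` f.g. torsion with `μ = 0`): `natCard_inf_inf_torsionBy_le`; ★ `natCard_torsionBy_selmerLayer_le_natCard_quotient_augIdealP` —
  **`#Sel_{p^∞}(E/K_n)[p] ≤ #(X/pX)` at EVERY layer** (`h_n` injective by the pro-`p` fixed-point principle, gen 43's `natCard_torsionBy_selmerLayer_le` and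
  `natCard_layerQuotientP_eq_natCard_torsionBy_selmerInvariants`, `X/(ω_n,p)X` a quotient of `X/pX`, finite by `finite_quotient_augIdealP_of_muInvariant_eq_zero`).
* §2 (`p = 2`, `K = ℚ`): ★★★ `exists_natCard_normKer_mul_kerG_lt_of_mu_eq_zero` and ★★★ `mu_eq_zero_iff_exists_natCard_normKer_mul_kerG_lt` — for `W/ℚ` elliptic, globally minimal,
  `IsOrdinaryAt W 2`, `∀ x, ¬HasRationalTwoTorsionX W x`, `κ` cyclotomic with topological generator `γ`, `D` torsion:
  **`μ(X(W/ℚ_∞)) = 0 ⟺ ∃ n, 0 < #ker(N_{ℚ_{n+1}/ℚ_n} | Sel_{2^∞}(W/ℚ_{n+1})) · #ker g_{n+1} < 2^{2ⁿ}`** — NO displayed hypothesis: road (a)'s stub T per datum is EQUIVALENT to ONE layer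
  `ℚ_{n+1}` at which the minus part of the honest `2^∞`-Selmer group (the kernel of the relative norm to `ℚ_n`), times Greenberg's control kernel, is smaller than `2^{2ⁿ}`.
What is NOT claimed: nothing about any curve; no Selmer group computed; C2 untouched. Memo `Cruxes/MainConjectureOfRankZeroBSDAtTwo/GROWTH-FINITE-att-p5-g57.md`.

References: R. Greenberg, LNM 1716 (1999), §1 pp. 60–62, Conj. 1.11, §3 Lemmas 3.1–3.5, §4 Lemma 4.3 [GreenbergLNM1716]; B. Mazur, Invent. Math. 18 (1972) §6 [Mazur1972];
L. Washington, GTM 83 §13.2–13.3 [Washington1997]; T. Fukuda, Proc. Japan Acad. 70 (1994) Thm. 1 [Fukuda1994].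
-/

set_option linter.dupNamespace false
set_option autoImplicit false

noncomputable section

open scoped Classical AddSubgroup Polynomial

namespace Summit.BirchSwinnertonDyer.BirchSwinnertonDyer.Theorems.AlignedTransportAtTwoHalfDescentLayerIndexGrowthFiniteCompleteNorm

open WeierstrassCurve Literature.NumberTheory.EllipticCurves Literature.NumberTheory.EllipticCurves.IwasawaDual
  Literature.NumberTheory.EllipticCurves.IwasawaAlgebra Literature.NumberTheory.IwasawaTheory.IwasawaModuleRankJump
  Literature.NumberTheory.EllipticCurves.Greenberg1999
  Summit.BirchSwinnertonDyer.Rank1Residual.X1.MuLambda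
  Summit.BirchSwinnertonDyer.Rank1Residual.Iwasawa
  Summit.BirchSwinnertonDyer.BirchSwinnertonDyer.Theorems.AlignedTransportAtTwoSelmerLayerMuDoorCount
  Summit.BirchSwinnertonDyer.BirchSwinnertonDyer.Theorems.AlignedTransportAtTwoSelmerLayerMuDoor
  Summit.BirchSwinnertonDyer.BirchSwinnertonDyer.Theorems.AlignedTransportAtTwoHalfDescentLayerIndexBounded
  Summit.BirchSwinnertonDyer.BirchSwinnertonDyer.Theorems.AlignedTransportAtTwoHalfDescentLayerIndexGrowthFinite
  Summit.BirchSwinnertonDyer.BirchSwinnertonDyer.Theorems.AlignedTransportAtTwoHalfDescentLayerIndexGrowthFiniteTwo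
  Summit.BirchSwinnertonDyer.BirchSwinnertonDyer.Theorems.AlignedTransportAtTwoHalfDescentLayerIndexGrowthFiniteComplete
  Summit.BirchSwinnertonDyer.BirchSwinnertonDyer.Theorems.AlignedTransportAtTwoHalfDescentLayerIndexGrowthFiniteCompleteTwo
  Summit.BirchSwinnertonDyer.BirchSwinnertonDyer.Theorems.AlignedTransportAtTwoHalfDescentLayerIndexGrowthFiniteCell

/-! ## §1 The `2`-torsion of the norm kernel is bounded when `μ = 0` -/

section Bound

variable {K : Type} [Field K] [NumberField K] (W : WeierstrassCurve K) {p : ℕ} [hp : Fact p.Prime] (κ : ZpExtension K p)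
  {γ : Field.absoluteGaloisGroup K}

omit hp in
/-- `#(S ⊓ S' ⊓ X[p]) ≤ #((↥S)[p])` for subgroups `S, S'` of an abelian group `X` (`(↥S)[p]` finite). [folklore] -/
theorem natCard_inf_inf_torsionBy_le {X : Type*} [AddCommGroup X] (S S' : AddSubgroup X) [Finite ((↥S)[(p : ℤ)])] :
    Nat.card ↥(S ⊓ S' ⊓ AddSubgroup.torsionBy X p) ≤ Nat.card ((↥S)[(p : ℤ)]) := by
  let f : ↥(S ⊓ S' ⊓ AddSubgroup.torsionBy X p) → (↥S)[(p : ℤ)] := fun x ↦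
    ⟨⟨x.1, (AddSubgroup.mem_inf.mp (AddSubgroup.mem_inf.mp x.2).1).1⟩, by
      have hx : p • (x.1 : X) = 0 := AddSubgroup.torsionBy.nsmul_iff.mp (AddSubgroup.mem_inf.mp x.2).2
      exact AddSubgroup.torsionBy.nsmul_iff.mpr (Subtype.ext (by rw [AddSubgroupClass.coe_nsmul]; exact hx))⟩
  have hf : Function.Injective f := fun a b h ↦ Subtype.ext (congrArg (fun y : (↥S)[(p : ℤ)] ↦ ((y : ↥S) : X)) h)
  exact Nat.card_le_card_of_injective f hf

/-- ★ **`μ(X(E/K_∞)) = 0` and `E(K)[p] = 0` ⟹ `#Sel_{p^∞}(E/K_n)[p] ≤ #(X/pX)` at EVERY layer** (`h_n` injective, `#Sel_n[p] ≤ #Sel_∞^{Γ_n}[p] = #(X/(ω_n,p)X) ≤ #(X/pX)`, finite when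
`μ = 0`: gen 43's rank-jump currency). [cite: GreenbergLNM1716, §1 pp. 60–62, §3 Lemma 3.1] [cite: Washington1997, §13.2] -/
theorem natCard_torsionBy_selmerLayer_le_natCard_quotient_augIdealP [W.IsElliptic] (hK : ∀ P : W.toAffine.Point, p • P = 0 → P = 0) (hγ : κ.IsTopGenerator γ)
    (D : W.SelmerDualData κ γ) [Module.Finite (IwasawaAlgebra p) D.X] (hD : D.IsTorsion) (hμ : D.mu = 0) (n : ℕ) :
    Finite ((↥(W.selmerLayer κ n))[(p : ℤ)]) ∧
      Nat.card ((↥(W.selmerLayer κ n))[(p : ℤ)]) ≤ Nat.card (D.X ⧸ augIdealP p • (⊤ : Submodule (IwasawaAlgebra p) D.X)) := by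
  haveI := finite_torsionBy_selmerInvariants p W κ hγ D n
  haveI : Finite (D.X ⧸ augIdealP p • (⊤ : Submodule (IwasawaAlgebra p) D.X)) := finite_quotient_augIdealP_of_muInvariant_eq_zero hD hμ
  have hinj := layerToInfty_injective_of_fixedPoints_eq_bot W κ hγ (W.fixedPoints_kerSubgroup_geomPrimaryTorsion_eq_bot κ hK) n
  obtain ⟨hfin, hle⟩ := natCard_torsionBy_selmerLayer_le W κ n hinj
  refine ⟨hfin, hle.trans ?_⟩
  rw [← natCard_layerQuotientP_eq_natCard_torsionBy_selmerInvariants p W κ hγ D n]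
  -- `X/(ω_n, p)X` is a quotient of `X/pX`
  set P : Submodule (IwasawaAlgebra p) D.X := augIdealP p • ⊤ with hP
  set Q : Submodule (IwasawaAlgebra p) D.X :=
    (Ideal.span {((1 + PowerSeries.X : PowerSeries ℤ_[p]) ^ (p ^ n) - 1 : IwasawaAlgebra p)} ⊔ augIdealP p) • ⊤ with hQ
  have hPQ : P ≤ Q := Submodule.smul_mono_left le_sup_right
  have hsurj : Function.Surjective (Submodule.mapQ P Q LinearMap.id hPQ) := by
    intro x
    induction x using Submodule.Quotient.induction_on with
    | H m => exact ⟨Submodule.Quotient.mk m, rfl⟩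
  exact Nat.card_le_card_of_surjective _ hsurj

end Bound

/-! ## §2 `p = 2`: completeness of the norm-kernel door on the cell -/

section Two

variable (W : WeierstrassCurve ℚ) [W.IsElliptic] [W.IsGloballyMinimal] (κ : ZpExtension ℚ 2) {γ : Field.absoluteGaloisGroup ℚ}

/-- ★★★ `p = 2`: **`μ(X(W/ℚ_∞)) = 0` ⟹ at some layer `0 < #ker(N_{ℚ_{n+1}/ℚ_n} | Sel_{2^∞}(W/ℚ_{n+1})) · #ker g_{n+1} < 2^{2ⁿ}`** for every `W/ℚ` elliptic, globally minimal, good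
ordinary at `2`, WITHOUT rational `2`-torsion abscissa, every cyclotomic `(κ, γ)` and every torsion datum: `#M_{n+1} ∣ g_n·#M_{n+1}[2]` (file VI), `g_n ≤ B` (file IV),
`#M_{n+1}[2] ≤ #Sel_{n+1}[2] ≤ #(X/2X)` (§1), `#ker g_{n+1} ≤ C` (file V), against `2^{2ⁿ} → ∞`. [cite: GreenbergLNM1716, Conj. 1.11, §3 Lemmas 3.1–3.5, §4 Lemma 4.3] [cite: Mazur1972, §6] -/
theorem exists_natCard_normKer_mul_kerG_lt_of_mu_eq_zero (hord : IsOrdinaryAt W 2) (ht : ∀ x : ℚ, ¬ HasRationalTwoTorsionX W x) (hκ : κ.IsCyclotomic)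
    (hγ : κ.IsTopGenerator γ) (D : W.SelmerDualData κ γ) (hD : D.IsTorsion) (hμ : D.mu = 0) :
    ∃ n : ℕ, 0 < Nat.card ↥(W.selmerLayer κ (n + 1) ⊓
            (W.conjH1 2 (κ.layerSubgroup (n + 1)) (γ ^ 2 ^ n) + AddMonoidHom.id (W.subgroupH1 2 (κ.layerSubgroup (n + 1)))).ker) *
          Nat.card (W.KerG κ (n + 1)) ∧
      Nat.card ↥(W.selmerLayer κ (n + 1) ⊓
            (W.conjH1 2 (κ.layerSubgroup (n + 1)) (γ ^ 2 ^ n) + AddMonoidHom.id (W.subgroupH1 2 (κ.layerSubgroup (n + 1)))).ker) *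
          Nat.card (W.KerG κ (n + 1)) < 2 ^ (2 ^ n) := by
  haveI : Module.Finite (IwasawaAlgebra 2) D.X := D.module_finite_holds hγ
  obtain ⟨C, hC⟩ := exists_forall_natCard_kerG_pos_le_two W κ hord hκ
  obtain ⟨n₀, B, -, hB⟩ := exists_forall_natCard_growth_pos_and_le (M := D.X) hD hμ
  set P₂ := Nat.card (D.X ⧸ augIdealP 2 • (⊤ : Submodule (IwasawaAlgebra 2) D.X)) with hP₂
  obtain ⟨n, hn, hlt⟩ := exists_linear_lt_pow (p := 2) 0 (B * P₂ * C) n₀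
  rw [zero_mul, zero_add, show (2 : ℕ) - 1 = 1 from rfl, mul_one] at hlt
  obtain ⟨hgpos, hgle⟩ := hB n hn
  obtain ⟨-, -, hdvd⟩ := growth_dvd_normKer_mul_kerG_and_normKer_dvd W κ ht hγ D n
  obtain ⟨hfin, hle₂⟩ := natCard_torsionBy_selmerLayer_le_natCard_quotient_augIdealP W κ (forall_two_nsmul_eq_zero W ht) hγ D hD hμ (n + 1)
  haveI := hfin
  -- the `2`-torsion factor of the norm kernel
  set t := Nat.card ↥(W.selmerLayer κ (n + 1) ⊓
      (W.conjH1 2 (κ.layerSubgroup (n + 1)) (γ ^ 2 ^ n) + AddMonoidHom.id (W.subgroupH1 2 (κ.layerSubgroup (n + 1)))).ker ⊓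
    AddSubgroup.torsionBy (W.subgroupH1 2 (κ.layerSubgroup (n + 1))) 2) with ht_def
  have ht_le : t ≤ P₂ := (natCard_inf_inf_torsionBy_le (p := 2) _ _).trans hle₂
  haveI : Finite ↥(W.selmerLayer κ (n + 1) ⊓
      (W.conjH1 2 (κ.layerSubgroup (n + 1)) (γ ^ 2 ^ n) + AddMonoidHom.id (W.subgroupH1 2 (κ.layerSubgroup (n + 1)))).ker ⊓
    AddSubgroup.torsionBy (W.subgroupH1 2 (κ.layerSubgroup (n + 1))) 2) :=
    Finite.of_injective _ (fun a b h ↦ by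
      have := congrArg (fun y : (↥(W.selmerLayer κ (n + 1)))[(2 : ℤ)] ↦ ((y : ↥(W.selmerLayer κ (n + 1))) : W.subgroupH1 2 (κ.layerSubgroup (n + 1)))) h
      exact Subtype.ext this :
      Function.Injective (fun x : ↥(W.selmerLayer κ (n + 1) ⊓
          (W.conjH1 2 (κ.layerSubgroup (n + 1)) (γ ^ 2 ^ n) + AddMonoidHom.id (W.subgroupH1 2 (κ.layerSubgroup (n + 1)))).ker ⊓
        AddSubgroup.torsionBy (W.subgroupH1 2 (κ.layerSubgroup (n + 1))) 2) ↦
        (⟨⟨x.1, (AddSubgroup.mem_inf.mp (AddSubgroup.mem_inf.mp x.2).1).1⟩, by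
          have hx : 2 • (x.1 : W.subgroupH1 2 (κ.layerSubgroup (n + 1))) = 0 := AddSubgroup.torsionBy.nsmul_iff.mp (AddSubgroup.mem_inf.mp x.2).2
          exact AddSubgroup.torsionBy.nsmul_iff.mpr (Subtype.ext (by rw [AddSubgroupClass.coe_nsmul]; exact hx))⟩ :
          (↥(W.selmerLayer κ (n + 1)))[(2 : ℤ)])))
  have ht_pos : 0 < t := Nat.card_pos
  have hMpos := Nat.pos_of_dvd_of_pos hdvd (Nat.mul_pos hgpos ht_pos)
  have hMle := (Nat.le_of_dvd (Nat.mul_pos hgpos ht_pos) hdvd).trans (Nat.mul_le_mul hgle ht_le)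
  refine ⟨n, Nat.mul_pos hMpos (hC (n + 1)).1, ?_⟩
  calc _ ≤ B * P₂ * C := Nat.mul_le_mul hMle (hC (n + 1)).2
    _ < 2 ^ n := hlt
    _ ≤ 2 ^ (2 ^ n) := Nat.pow_le_pow_right Nat.two_pos Nat.lt_two_pow_self.le

/-- ★★★ `p = 2`: **THE NORM-KERNEL DOOR IS COMPLETE ON THE SEED CELL: `μ(X(W/ℚ_∞)) = 0 ⟺ ∃ n, 0 < #ker(N_{ℚ_{n+1}/ℚ_n} | Sel_{2^∞}(W/ℚ_{n+1})) · #ker g_{n+1} < 2^{2ⁿ}`**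
(`W/ℚ` elliptic, globally minimal, good ordinary at `2`, no rational `2`-torsion abscissa; `κ` cyclotomic, `γ` a topological generator; `X` torsion). [cite: GreenbergLNM1716, Conj. 1.11, §3, §4 Lemma 4.3] -/
theorem mu_eq_zero_iff_exists_natCard_normKer_mul_kerG_lt (hord : IsOrdinaryAt W 2) (ht : ∀ x : ℚ, ¬ HasRationalTwoTorsionX W x) (hκ : κ.IsCyclotomic)
    (hγ : κ.IsTopGenerator γ) (D : W.SelmerDualData κ γ) (hD : D.IsTorsion) :
    D.mu = 0 ↔ ∃ n : ℕ, 0 < Nat.card ↥(W.selmerLayer κ (n + 1) ⊓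
            (W.conjH1 2 (κ.layerSubgroup (n + 1)) (γ ^ 2 ^ n) + AddMonoidHom.id (W.subgroupH1 2 (κ.layerSubgroup (n + 1)))).ker) *
          Nat.card (W.KerG κ (n + 1)) ∧
      Nat.card ↥(W.selmerLayer κ (n + 1) ⊓
            (W.conjH1 2 (κ.layerSubgroup (n + 1)) (γ ^ 2 ^ n) + AddMonoidHom.id (W.subgroupH1 2 (κ.layerSubgroup (n + 1)))).ker) *
          Nat.card (W.KerG κ (n + 1)) < 2 ^ (2 ^ n) := by
  haveI : Module.Finite (IwasawaAlgebra 2) D.X := D.module_finite_holds hγ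
  exact ⟨fun hμ ↦ exists_natCard_normKer_mul_kerG_lt_of_mu_eq_zero W κ hord ht hκ hγ D hD hμ,
    fun ⟨_, hpos, hlt⟩ ↦ mu_eq_zero_of_natCard_normKer_mul_kerG_lt W κ hγ D hD hpos hlt⟩

end Two

end Summit.BirchSwinnertonDyer.BirchSwinnertonDyer.Theorems.AlignedTransportAtTwoHalfDescentLayerIndexGrowthFiniteCompleteNorm

end
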